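import Mathlib
import Summits.Ventures.PercRepro2.Defs
import Summits.Ventures.PercRepro2.Graph
import Summits.Ventures.PercRepro2.Harris
import Summits.Ventures.PercRepro2.Events
import Summits.Ventures.PercRepro2.Independence
import Summits.Ventures.PercRepro2.Induced
import Summits.Ventures.PercRepro2.Exploration
import Summits.Ventures.PercRepro2.GateDefs
import Summits.Ventures.PercRepro2.GateAnatomy
import Summits.Ventures.PercRepro2.GateForest
import Summits.Ventures.PercRepro2.GateLSM
import Summits.Ventures.PercRepro2.HullTree
import Summits.Ventures.PercRepro2.GateFeedbackForest
import Summits.Ventures.PercRepro2.GateFeedback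
import Summits.Ventures.PercRepro2.GateFeedbackExit
import Summits.Ventures.PercRepro2.GateContract
import Summits.Ventures.PercRepro2.GateShadow
import Summits.Ventures.PercRepro2.GateSide
import Summits.Ventures.PercRepro2.GateSep
import Summits.Ventures.PercRepro2.SideCluster
import Summits.Ventures.PercRepro2.CactusDefs
import Summits.Ventures.PercRepro2.CactusTriangle
import Summits.Ventures.PercRepro2.CactusTriangleMass
import Summits.Ventures.PercRepro2.CactusCluster
import Summits.Ventures.PercRepro2.CactusDel
import Summits.Ventures.PercRepro2.CactusChain
import Summits.Ventures.PercRepro2.CactusKappa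

/-!
# The SUPPORT-CHAIN THEOREM: the FKG mechanism of the free gate in every graph
(blind cell PercRepro2, mine-c g11; proofs/MINEC-FEEDBACK.md §15)

In EVERY graph `massB W = 1[t,u,w ∉ W] · P(C(s) = W) · κ(W)` (`GateSep.massB_eq_connDel`), and
the free one-sided gate follows from the FKG lattice condition on `massB`. The SUPPORT of `massB`
consists of the root clusters `W` avoiding `t, u, w` around which `w` can still reach `t`
(`κ(W) > 0`). The lattice condition holds as soon as, on PAIRS OF SUPPORT CLUSTERS,
(a) the cluster law `W ↦ P(C(s) = W)` is log-supermodular, and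
(b) the exit components are nested: `w` reaches no vertex of `W₂` in `G − t − W₁`, or no vertex of
`W₁` in `G − t − W₂` (`kappa_lsm_of_dichotomy` turns (b) into the log-supermodularity
of `κ`; outside the support `massB` vanishes and the inequality is trivial).
`massBLogSupermod_of_support`, `gateRow_of_support`. Theorem 2 (`CactusGate.lean`) is the case
where (a) and (b) hold for ALL root clusters (the cactus `G − t`); the census (data/mine-c/g11,
chainprobe2.py) shows where (a)/(b) hold beyond cacti.
-/

namespace Summit.Ventures.PercRepro2

namespace GateSupport

open Cactus CactusChain CactusGate GateSide

open scoped Classical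

variable {V : Type*} {E : Type*} [Fintype E] [Fintype V]
variable {R : Type*} [Field R] [LinearOrder R] [IsStrictOrderedRing R]
variable {ends : E → Sym2 V}

omit [LinearOrder R] [IsStrictOrderedRing R] in
/-- A cluster of nonzero class-B mass avoids `t`, `u` and `w`. -/
lemma notMem_of_massB_ne_zero {p : E → R} {s t u w : V} {W : Finset V}
    (h : GateLSM.massB p ends s t u w W ≠ 0) : t ∉ W ∧ u ∉ W ∧ w ∉ W := by
  by_contra hc
  apply h
  rw [GateSep.massB_eq_connDel, if_pos (by tauto)]

/-- **THE SUPPORT-CHAIN THEOREM.** In every graph the class-B mass is log-supermodular provided,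
for all clusters `W₁, W₂` of nonzero class-B mass, (a) the cluster law is log-supermodular at the
pair and (b) the exit components are nested. -/
theorem massBLogSupermod_of_support {p : E → R} (hp : IsProbVec p) {s t u w : V} (hw : w ≠ t)
    (hν : ∀ W₁ W₂ : Finset V, GateLSM.massB p ends s t u w W₁ ≠ 0 →
      GateLSM.massB p ends s t u w W₂ ≠ 0 →
      prob p (clusterEvent ends s (↑W₁ : Set V)) * prob p (clusterEvent ends s (↑W₂ : Set V)) ≤
        prob p (clusterEvent ends s (↑(W₁ ∩ W₂) : Set V)) *
          prob p (clusterEvent ends s (↑(W₁ ∪ W₂) : Set V)))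
    (hχ : ∀ W₁ W₂ : Finset V, GateLSM.massB p ends s t u w W₁ ≠ 0 →
      GateLSM.massB p ends s t u w W₂ ≠ 0 →
      (∀ y ∈ W₂, ¬ Conn ends (delCfg ends (GateFeedback.Ft ends t) (↑W₁ : Set V)) w y) ∨
        (∀ y ∈ W₁, ¬ Conn ends (delCfg ends (GateFeedback.Ft ends t) (↑W₂ : Set V)) w y)) :
    GateLSM.MassBLogSupermod p ends s t u w := by
  intro W₁ W₂
  have hnn : ∀ W, 0 ≤ GateLSM.massB p ends s t u w W := fun W => prob_nonneg hp _
  by_cases hz₁ : GateLSM.massB p ends s t u w W₁ = 0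
  · rw [hz₁, zero_mul]; exact mul_nonneg (hnn _) (hnn _)
  by_cases hz₂ : GateLSM.massB p ends s t u w W₂ = 0
  · rw [hz₂, mul_zero]; exact mul_nonneg (hnn _) (hnn _)
  obtain ⟨ht₁, hu₁, hw₁⟩ := notMem_of_massB_ne_zero hz₁
  obtain ⟨ht₂, hu₂, hw₂⟩ := notMem_of_massB_ne_zero hz₂
  have hI : ¬ (t ∈ W₁ ∩ W₂ ∨ u ∈ W₁ ∩ W₂ ∨ w ∈ W₁ ∩ W₂) := by
    rintro (h | h | h)
    · exact ht₁ (Finset.mem_inter.1 h).1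
    · exact hu₁ (Finset.mem_inter.1 h).1
    · exact hw₁ (Finset.mem_inter.1 h).1
  have hU : ¬ (t ∈ W₁ ∪ W₂ ∨ u ∈ W₁ ∪ W₂ ∨ w ∈ W₁ ∪ W₂) := by
    rintro (h | h | h)
    · rcases Finset.mem_union.1 h with h | h
      · exact ht₁ h
      · exact ht₂ h
    · rcases Finset.mem_union.1 h with h | h
      · exact hu₁ h
      · exact hu₂ h
    · rcases Finset.mem_union.1 h with h | h
      · exact hw₁ h
      · exact hw₂ h
  have hA := hν W₁ W₂ hz₁ hz₂
  have hC := kappa_lsm_of_dichotomy hp ht₁ ht₂ hw (hχ W₁ W₂ hz₁ hz₂)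
  have hν0 : ∀ W, 0 ≤ prob p (clusterEvent ends s (↑W : Set V)) := fun W => prob_nonneg hp _
  have hκ0 : ∀ W, 0 ≤ prob p (connDelEvent ends W t w) := fun W => prob_nonneg hp _
  rw [GateSep.massB_eq_connDel p ends s t u w W₁, GateSep.massB_eq_connDel p ends s t u w W₂,
    GateSep.massB_eq_connDel p ends s t u w (W₁ ∩ W₂),
    GateSep.massB_eq_connDel p ends s t u w (W₁ ∪ W₂),
    if_neg (by simp only [not_or]; exact ⟨ht₁, hu₁, hw₁⟩),
    if_neg (by simp only [not_or]; exact ⟨ht₂, hu₂, hw₂⟩), if_neg hI, if_neg hU]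
  calc prob p (clusterEvent ends s (↑W₁ : Set V)) * prob p (connDelEvent ends W₁ t w) *
        (prob p (clusterEvent ends s (↑W₂ : Set V)) * prob p (connDelEvent ends W₂ t w))
      = (prob p (clusterEvent ends s (↑W₁ : Set V)) * prob p (clusterEvent ends s (↑W₂ : Set V))) *
        (prob p (connDelEvent ends W₁ t w) * prob p (connDelEvent ends W₂ t w)) := by ring
    _ ≤ (prob p (clusterEvent ends s (↑(W₁ ∩ W₂) : Set V)) *
          prob p (clusterEvent ends s (↑(W₁ ∪ W₂) : Set V))) *
        (prob p (connDelEvent ends (W₁ ∩ W₂) t w) * prob p (connDelEvent ends (W₁ ∪ W₂) t w)) :=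
        mul_le_mul hA hC (mul_nonneg (hκ0 _) (hκ0 _)) (mul_nonneg (hν0 _) (hν0 _))
    _ = _ := by ring

/-- **The free gate from the support conditions** (every graph). -/
theorem gateRow_of_support {p : E → R} (hp : IsProbVec p) (s t a b u w : V) (hw : w ≠ t)
    (hν : ∀ W₁ W₂ : Finset V, GateLSM.massB p ends s t u w W₁ ≠ 0 →
      GateLSM.massB p ends s t u w W₂ ≠ 0 →
      prob p (clusterEvent ends s (↑W₁ : Set V)) * prob p (clusterEvent ends s (↑W₂ : Set V)) ≤
        prob p (clusterEvent ends s (↑(W₁ ∩ W₂) : Set V)) *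
          prob p (clusterEvent ends s (↑(W₁ ∪ W₂) : Set V)))
    (hχ : ∀ W₁ W₂ : Finset V, GateLSM.massB p ends s t u w W₁ ≠ 0 →
      GateLSM.massB p ends s t u w W₂ ≠ 0 →
      (∀ y ∈ W₂, ¬ Conn ends (delCfg ends (GateFeedback.Ft ends t) (↑W₁ : Set V)) w y) ∨
        (∀ y ∈ W₁, ¬ Conn ends (delCfg ends (GateFeedback.Ft ends t) (↑W₂ : Set V)) w y)) :
    Gate.GateRow p ends s {t} a b {u} {w} :=
  GateSep.gateRow_of_massBLogSupermod hp s t a b u w (massBLogSupermod_of_support hp hw hν hχ)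

end GateSupport

end Summit.Ventures.PercRepro2
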